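import Summits.Parity.GeneralizedHardyLittlewood.Theorems.RelativeDimOne.Negative.RelativeDimOneLoadBearing
import Summits.Parity.GeneralizedHardyLittlewood.Theorems.LeeYangFibresPrimeCellsRelativeDimOneOne
import HarnessLib

/-!
# `RelativeDimOne` (stmt-Parity-14113): load-bearing hypotheses II, false strengthenings, true slices

Negative lemmas for the crux `LeeYangFibres.RelativeDimOne` (cdisprove seat, cycle 1), part 2
(vocabulary `Concl`, `lin`, `seg`, `pt` from part 1 `RelativeDimOneLoadBearing`):
* A4 `IsNondegenerateSystem Ψ` deleted is FALSE (`relativeDimOne_false_without_nondegenerate`): the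
  constant form `ψ = 0·n + 3` (`‖Ψ‖_N = 3/N`), `K = [-N,N]`: `S = (2N+1) log 3` while `𝔖 = 0` (`β_3 = 0`);
* A5 `0 < ε` and A6 `∃ N₀` deleted are FALSE (sanity; `ψ = n`, `K = [½, 3/2]` at `ε = 0`, resp. `N = 1`,
  `K = [½, 1]`, no `N = 0` junk used);
* B1 the STRENGTHENING to a purely relative error `ε·β_∞𝔖` is FALSE (`not_purelyRelativeDimOne`:
  `ψ = n`, `K = [½, 3/2]`, `S = Λ(1) = 0 ≠ 1 = β_∞𝔖` at every `N ≥ 2` — prime-free short bodies are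
  absorbed only by the `+ εN`); B2 a threshold `N₀` uniform in `L` is FALSE
  (`not_relativeDimOneUniformInSize`, witness A1 with `L := q`). The complementary strengthening, the
  absolute error `εN`, is `DimOne` = the open crux `AbsoluteUpgrade` (stmt-Parity-14116), not touched;
* C the hypothesis `1 ≤ t` is COSMETIC: the `t = 0` slice HOLDS (`relativeDimOneAtZero_holds`: `𝔖(∅) = 1`,
  `S` = lattice points of `K`, `β_∞ = vol K`, and `|# − vol| ≤ 1 ≤ ε(vol + N)` for `N ≥ 1/ε` by the tree's
  `DimOne.exists_filter_eq_Icc`);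
* C2 the `t = 1` slice HOLDS unconditionally (`relativeDimOneAtOne_holds`): the tree's
  `PrimeCellsRelative.Sketch.stub_dimOne_one` (Green–Tao 2010, Thm. 4.5 at level `1` + §4 reduction; one
  form has finite complexity) gives the absolute form, and absolute ⟹ relative since `S ≥ 0`. Hence every
  counterexample to the crux needs `t ≥ 2` (twin-prime territory). [folklore]
-/

noncomputable section

open scoped BigOperators Classical Topology
open Finset Filter MeasureTheory Set Literature.NumberTheory.Sieve
open Summit.Parity.GeneralizedHardyLittlewood.Theses.LeeYangFibres (RelativeDimOne DimOne)

namespace Summit.Parity.GeneralizedHardyLittlewood.Theorems.RelativeDimOne.Negative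

/-! ### A4. Non-degeneracy of `Ψ` -/

/-- The crux with the hypothesis `IsNondegenerateSystem Ψ` deleted. -/
def RelativeDimOneWithoutNondegenerate : Prop :=
  ∀ (t L : ℕ), 1 ≤ t → ∀ ε : ℝ, 0 < ε → ∃ N₀ : ℕ, ∀ N : ℕ, N₀ ≤ N →
    ∀ Ψ : Fin t → AffLinForm 1, affLinSize Ψ N ≤ L →
      ∀ K : Set (Fin 1 → ℝ), Convex ℝ K → K ⊆ realBox 1 N → Concl ε N Ψ K

/-- Sanity: the variant is the crux minus a hypothesis (it implies the crux). -/
theorem relativeDimOneWithoutNondegenerate_imp :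
    RelativeDimOneWithoutNondegenerate → RelativeDimOne := by
  intro h t L ht ε hε
  obtain ⟨N₀, hN₀⟩ := h t L ht ε hε
  exact ⟨N₀, fun N hN Ψ _ hL K hK hKN => hN₀ N hN Ψ hL K hK hKN⟩

/-- `𝔖(0·n + 3) = 0`: the local factor at `3` vanishes, so all partial products from `x = 3` on are
`0` and the ordered limit is `0` (no non-degeneracy is needed for an eventually constant sequence). -/
theorem singularProduct_const_three : singularProduct (lin 0 3) = 0 := by
  have hβ : localFactor (lin 0 3) 3 = 0 := by
    rw [OneForm.localFactor_eq (lin 0 3) Nat.prime_three]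
    simp [lin]
  have hev : ∀ x : ℕ, 3 ≤ x → singularProductPartial (lin 0 3) x = 0 := fun x hx =>
    Finset.prod_eq_zero (Nat.mem_primesLE.mpr ⟨hx, Nat.prime_three⟩) hβ
  have hlim : Tendsto (singularProductPartial (lin 0 3)) atTop (𝓝 0) :=
    tendsto_const_nhds.congr' (eventually_atTop.2 ⟨3, fun x hx => (hev x hx).symm⟩)
  rw [singularProduct, hlim.limUnder_eq]

/-- `S(3; [-N,N], N) = (2N+1)·log 3`: every lattice point of the box contributes `Λ(3)`. -/
theorem vonMangoldtSum_const_three (N : ℕ) :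
    vonMangoldtSum (lin 0 3) (realBox 1 N) N = (2 * N + 1) * Real.log 3 := by
  unfold vonMangoldtSum
  rw [Finset.filter_true_of_mem]
  swap
  · intro n hn
    have hn' := mem_latticeBox_one hn
    simp only [realBox, Set.mem_Icc, Pi.le_def, Fin.forall_fin_one, realPoint]
    exact ⟨by exact_mod_cast hn'.1, by exact_mod_cast hn'.2⟩
  have hterm : ∀ n ∈ latticeBox 1 N, ∏ i, intVonMangoldt ((lin 0 3 i).eval n) = Real.log 3 := by
    intro n _
    simp [lin_eval, intVonMangoldt, ArithmeticFunction.vonMangoldt_apply_prime Nat.prime_three]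
  rw [Finset.sum_congr rfl hterm, Finset.sum_const, nsmul_eq_mul]
  congr 1
  rw [latticeBox, Fintype.card_piFinset, Finset.prod_const, Finset.card_univ, Fintype.card_fin,
    pow_one, Int.card_Icc]
  have : ((N : ℤ) + 1 - -(N : ℤ)).toNat = 2 * N + 1 := by omega
  rw [this]
  push_cast
  ring

/-- **Non-degeneracy is load-bearing.** Witness: `t = 1`, the CONSTANT form `ψ(n) = 0·n + 3`
(`‖Ψ‖_N = 3/N ≤ 3`), `K = [-N, N]`: `S = (2N+1) log 3` while `𝔖 = 0` (`β_3 = 0`), so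
`|S − 0| ≤ 1·(0 + N)` fails. (Deleting only the first clause `ψ̇ᵢ ≠ 0` of `IsNondegenerateSystem`
already breaks the statement; for the second clause see §D, witness `(n, n)`.) -/
theorem relativeDimOne_false_without_nondegenerate : ¬ RelativeDimOneWithoutNondegenerate := by
  intro h
  obtain ⟨N₀, hN₀⟩ := h 1 3 le_rfl 1 one_pos
  set N := max N₀ 1 with hNdef
  have hN1 : 1 ≤ N := le_max_right _ _
  have hNr : (1 : ℝ) ≤ N := by exact_mod_cast hN1
  have hsize : affLinSize (lin 0 3) N ≤ 3 := by
    rw [affLinSize_lin]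
    simp only [Int.cast_zero, abs_zero, zero_add, Int.cast_ofNat]
    rw [abs_of_nonneg (by positivity), div_le_iff₀ (by linarith)]
    linarith
  have key := hN₀ N (le_max_left _ _) (lin 0 3) hsize (realBox 1 N) (convex_Icc _ _) subset_rfl
  unfold Concl at key
  rw [vonMangoldtSum_const_three, singularProduct_const_three] at key
  simp only [mul_zero, sub_zero, zero_add, one_mul] at key
  have hlog3 : (1 : ℝ) < Real.log 3 := by
    rw [Real.lt_log_iff_exp_lt (by norm_num)]
    have := Real.exp_one_lt_d9
    linarith
  have hpos : (0 : ℝ) ≤ (2 * N + 1) * Real.log 3 := by positivity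
  rw [abs_of_nonneg hpos] at key
  nlinarith

/-! ### A5. Positivity of `ε` -/

/-- The crux with the hypothesis `0 < ε` deleted. -/
def RelativeDimOneWithoutEpsPos : Prop :=
  ∀ (t L : ℕ), 1 ≤ t → ∀ ε : ℝ, ∃ N₀ : ℕ, ∀ N : ℕ, N₀ ≤ N →
    ∀ Ψ : Fin t → AffLinForm 1, IsNondegenerateSystem Ψ → affLinSize Ψ N ≤ L →
      ∀ K : Set (Fin 1 → ℝ), Convex ℝ K → K ⊆ realBox 1 N → Concl ε N Ψ K

/-- Sanity: the variant is the crux minus a hypothesis (it implies the crux). -/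
theorem relativeDimOneWithoutEpsPos_imp : RelativeDimOneWithoutEpsPos → RelativeDimOne := by
  intro h t L ht ε _
  exact h t L ht ε

/-- `S(n; [½, c], N) = 0` for `c < 2`: the only lattice point is `n = 1`, and `Λ(1) = 0`. -/
theorem vonMangoldtSum_id_seg_half {c : ℝ} (hc : c < 2) (N : ℕ) :
    vonMangoldtSum (lin 1 0) (seg (1 / 2) c) N = 0 := by
  refine vonMangoldtSum_eq_zero_of_forall _ fun n _ hK => ?_
  have h := mem_seg.mp hK
  simp only [realPoint] at h
  have h1 : (0 : ℝ) < n 0 := by linarith [h.1]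
  have h2 : ((n 0 : ℤ) : ℝ) < 2 := by linarith [h.2]
  have h3 : n 0 = 1 := by
    have : (0 : ℤ) < n 0 := by exact_mod_cast h1
    have : n 0 < 2 := by exact_mod_cast h2
    omega
  simp [lin_eval, intVonMangoldt, h3]

/-- At `(n; [½, 3/2])`, `N ≥ 2`: `S = 0`, `β_∞ 𝔖 = 1`, so `Concl ε` reads `1 ≤ ε (1 + N)`. -/
theorem concl_id_seg_half_iff {ε : ℝ} {N : ℕ} :
    Concl ε N (lin 1 0) (seg (1 / 2) (3 / 2)) ↔ 1 ≤ ε * (1 + N) := by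
  unfold Concl
  rw [vonMangoldtSum_id_seg_half (by norm_num), archFactor_id_seg (by norm_num) (by norm_num),
    singularProduct_id]
  norm_num

/-- **`0 < ε` is load-bearing** (sanity). Witness at `ε = 0`: `ψ(n) = n`, `K = [½, 3/2]`:
`S = Λ(1) = 0 ≠ 1 = β_∞ 𝔖`. -/
theorem relativeDimOne_false_without_epsPos : ¬ RelativeDimOneWithoutEpsPos := by
  intro h
  obtain ⟨N₀, hN₀⟩ := h 1 1 le_rfl 0
  set N := max N₀ 2 with hNdef
  have hN2 : 2 ≤ N := le_max_right _ _
  have hNr : (2 : ℝ) ≤ N := by exact_mod_cast hN2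
  have key := hN₀ N (le_max_left _ _) (lin 1 0) (isNondegenerateSystem_lin one_ne_zero 0)
    (by rw [affLinSize_lin]; simp) (seg (1 / 2) (3 / 2)) (convex_seg _ _)
    (seg_subset_realBox (by linarith) (by linarith))
  rw [concl_id_seg_half_iff] at key
  linarith

/-! ### A6. The threshold `N₀` -/

/-- The crux with `∃ N₀, ∀ N ≥ N₀` replaced by `∀ N`. -/
def RelativeDimOneWithoutThreshold : Prop :=
  ∀ (t L : ℕ), 1 ≤ t → ∀ ε : ℝ, 0 < ε → ∀ N : ℕ,
    ∀ Ψ : Fin t → AffLinForm 1, IsNondegenerateSystem Ψ → affLinSize Ψ N ≤ L →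
      ∀ K : Set (Fin 1 → ℝ), Convex ℝ K → K ⊆ realBox 1 N → Concl ε N Ψ K

/-- Sanity: the variant is the crux minus a hypothesis (it implies the crux). -/
theorem relativeDimOneWithoutThreshold_imp : RelativeDimOneWithoutThreshold → RelativeDimOne := by
  intro h t L ht ε hε
  exact ⟨0, fun N _ => h t L ht ε hε N⟩

/-- **The threshold is load-bearing** (sanity; no junk used). Witness at `N = 1`: `ψ(n) = n`,
`K = [½, 1] ⊆ [-1, 1]`: `S = Λ(1) = 0`, `β_∞ 𝔖 = ½`, and `½ ≤ ¼ (½ + 1)` fails. (At `N = 0` the size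
`‖Ψ‖_0` even forgets the constants, `|b/0| = 0` in Lean — provers take `N₀ ≥ 1`.) -/
theorem relativeDimOne_false_without_threshold : ¬ RelativeDimOneWithoutThreshold := by
  intro h
  have key := h 1 1 le_rfl (1 / 4) (by norm_num) 1 (lin 1 0) (isNondegenerateSystem_lin one_ne_zero 0)
    (by rw [affLinSize_lin]; simp) (seg (1 / 2) 1) (convex_seg _ _)
    (seg_subset_realBox (by norm_num) (by norm_num))
  unfold Concl at key
  rw [vonMangoldtSum_id_seg_half (by norm_num), archFactor_id_seg (by norm_num) (by norm_num),
    singularProduct_id] at key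
  norm_num [abs_of_pos] at key

/-! ## §B Natural strengthenings that are FALSE -/

/-! ### B1. Purely relative error (drop the `+ N`) -/

/-- The crux with the conclusion strengthened to a purely RELATIVE error `ε · β_∞ 𝔖`. -/
def PurelyRelativeDimOne : Prop :=
  ∀ (t L : ℕ), 1 ≤ t → ∀ ε : ℝ, 0 < ε → ∃ N₀ : ℕ, ∀ N : ℕ, N₀ ≤ N →
    ∀ Ψ : Fin t → AffLinForm 1, IsNondegenerateSystem Ψ → affLinSize Ψ N ≤ L →
      ∀ K : Set (Fin 1 → ℝ), Convex ℝ K → K ⊆ realBox 1 N →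
        |vonMangoldtSum Ψ K N - archFactor Ψ K * singularProduct Ψ| ≤
          ε * (archFactor Ψ K * singularProduct Ψ)

/-- **The absolute slack `+ εN` cannot be dropped.** Witness: `ψ(n) = n`, `K = [½, 3/2]` (unit
length, one lattice point `1`, `Λ(1) = 0`): `|0 − 1| ≤ ε·1` fails for `ε = ½` at every `N ≥ 2`. Short
bodies carry no primes; only the `εN` absorbs them. -/
theorem not_purelyRelativeDimOne : ¬ PurelyRelativeDimOne := by
  intro h
  obtain ⟨N₀, hN₀⟩ := h 1 1 le_rfl (1 / 2) (by norm_num)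
  set N := max N₀ 2 with hNdef
  have hN2 : 2 ≤ N := le_max_right _ _
  have hNr : (2 : ℝ) ≤ N := by exact_mod_cast hN2
  have key := hN₀ N (le_max_left _ _) (lin 1 0) (isNondegenerateSystem_lin one_ne_zero 0)
    (by rw [affLinSize_lin]; simp) (seg (1 / 2) (3 / 2)) (convex_seg _ _)
    (seg_subset_realBox (by linarith) (by linarith))
  rw [vonMangoldtSum_id_seg_half (by norm_num), archFactor_id_seg (by norm_num) (by norm_num),
    singularProduct_id] at key
  norm_num [abs_of_pos] at key

/-! ### B2. A threshold uniform in the size `L` -/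

/-- The crux with `N₀` chosen BEFORE `L` (uniformity in the size of the system). -/
def RelativeDimOneUniformInSize : Prop :=
  ∀ t : ℕ, 1 ≤ t → ∀ ε : ℝ, 0 < ε → ∃ N₀ : ℕ, ∀ L : ℕ, ∀ N : ℕ, N₀ ≤ N →
    ∀ Ψ : Fin t → AffLinForm 1, IsNondegenerateSystem Ψ → affLinSize Ψ N ≤ L →
      ∀ K : Set (Fin 1 → ℝ), Convex ℝ K → K ⊆ realBox 1 N → Concl ε N Ψ K

/-- Sanity: the variant strengthens the crux (it implies the crux). -/
theorem relativeDimOneUniformInSize_imp : RelativeDimOneUniformInSize → RelativeDimOne := by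
  intro h t L ht ε hε
  obtain ⟨N₀, hN₀⟩ := h t ht ε hε
  exact ⟨N₀, hN₀ L⟩

/-- **`N₀` must depend on `L`.** Same witness as A1 with `L := q`: `ψ(n) = q n`, `q` prime `> e^N`,
`‖Ψ‖_N = q ≤ L`, `K = {(1)}`, `S = log q > N = 1·(0 + N)`. -/
theorem not_relativeDimOneUniformInSize : ¬ RelativeDimOneUniformInSize := by
  intro h
  obtain ⟨N₀, hN₀⟩ := h 1 le_rfl 1 one_pos
  obtain ⟨q, hq, hlog⟩ := exists_prime_log_gt (max N₀ 1)
  have hq0 : (q : ℤ) ≠ 0 := by exact_mod_cast hq.ne_zero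
  refine not_concl_scaled_pt hq (le_max_right _ _) hlog
    (hN₀ q (max N₀ 1) (le_max_left _ _) (lin q 0) (isNondegenerateSystem_lin hq0 0) ?_ pt convex_pt
      (pt_subset_realBox (le_max_right _ _)))
  rw [affLinSize_lin]
  simp

/-! ## §C The hypothesis `1 ≤ t` is NOT load-bearing: the `t = 0` slice is TRUE -/

/-- The crux body at `t = 0` (empty system: `S` = number of lattice points of `K`, `β_∞ = vol K`,
`𝔖 = 1`). -/
def RelativeDimOneAtZero : Prop :=
  ∀ L : ℕ, ∀ ε : ℝ, 0 < ε → ∃ N₀ : ℕ, ∀ N : ℕ, N₀ ≤ N →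
    ∀ Ψ : Fin 0 → AffLinForm 1, IsNondegenerateSystem Ψ → affLinSize Ψ N ≤ L →
      ∀ K : Set (Fin 1 → ℝ), Convex ℝ K → K ⊆ realBox 1 N → Concl ε N Ψ K

/-- `𝔖(∅) = 1`: every local factor of the empty system is `p⁻¹ · p = 1`. -/
theorem singularProduct_fin_zero (Ψ : Fin 0 → AffLinForm 1) : singularProduct Ψ = 1 := by
  have hβ : ∀ p : ℕ, p.Prime → localFactor Ψ p = 1 := by
    intro p hp
    unfold localFactor
    simp only [Finset.univ_eq_empty, Finset.prod_empty, Finset.sum_const, Fintype.card_piFinset,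
      Finset.card_range, nsmul_eq_mul, mul_one, pow_one]
    have hp0 : (p : ℝ) ≠ 0 := by exact_mod_cast hp.ne_zero
    simp [hp0]
  have hev : ∀ x : ℕ, singularProductPartial Ψ x = 1 := fun x =>
    Finset.prod_eq_one fun p hp => hβ p (Nat.mem_primesLE.mp hp).2
  have hlim : Tendsto (singularProductPartial Ψ) atTop (𝓝 1) :=
    tendsto_const_nhds.congr' (Eventually.of_forall fun x => (hev x).symm)
  rw [singularProduct, hlim.limUnder_eq]

/-- `S(∅; K, N)` is the number of lattice points of `K`. -/
theorem vonMangoldtSum_fin_zero (Ψ : Fin 0 → AffLinForm 1) (K : Set (Fin 1 → ℝ)) (N : ℕ) :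
    vonMangoldtSum Ψ K N = #((latticeBox 1 N).filter (fun n => realPoint n ∈ K)) := by
  unfold vonMangoldtSum
  simp

/-- `β_∞(∅; K)` is the length of the slice of `K`. -/
theorem archFactor_fin_zero (Ψ : Fin 0 → AffLinForm 1) (K : Set (Fin 1 → ℝ)) :
    archFactor Ψ K = (volume {r : ℝ | (fun _ : Fin 1 => r) ∈ K}).toReal := by
  rw [DimOne.archFactor_eq]
  simp

/-- **The `t = 0` slice of the crux holds** (so `1 ≤ t` is cosmetic): for a convex `K ⊆ [-N, N]` the
lattice-point count and the length differ by at most `1 ≤ ε (vol K + N)` once `N ≥ 1/ε`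
(tree: `DimOne.exists_filter_eq_Icc`). -/
theorem relativeDimOneAtZero_holds : RelativeDimOneAtZero := by
  intro L ε hε
  refine ⟨⌈1 / ε⌉₊, fun N hN Ψ _ _ K hK hKN => ?_⟩
  have hNε : 1 / ε ≤ N := (Nat.le_ceil _).trans (by exact_mod_cast hN)
  have hεN : 1 ≤ ε * N := by
    rw [div_le_iff₀ hε] at hNε
    linarith
  unfold Concl
  rw [vonMangoldtSum_fin_zero, archFactor_fin_zero, singularProduct_fin_zero, mul_one,
    DimOne.card_filter_latticeBox]
  set S : Set ℝ := {r : ℝ | (fun _ : Fin 1 => r) ∈ K} with hSdef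
  have hS : S.OrdConnected := (DimOne.convex_slice hK).ordConnected
  have hSN : S ⊆ Set.Icc (-(N : ℝ)) N := by
    intro r hr
    have := hKN hr
    simp only [realBox, Set.mem_Icc, Pi.le_def, Fin.forall_fin_one] at this
    exact this
  obtain ⟨m₁, m₂, hI, hvol⟩ := DimOne.exists_filter_eq_Icc (N := N) hS hSN
  have hI' : (Finset.Icc (-(N : ℤ)) N).filter (fun m : ℤ => realPoint (fun _ : Fin 1 => m) ∈ K) =
      Finset.Icc m₁ m₂ := by
    rw [← hI]
    rfl
  rw [hI']
  have hvol0 : 0 ≤ (volume S).toReal := ENNReal.toReal_nonneg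
  calc |(#(Finset.Icc m₁ m₂) : ℝ) - (volume S).toReal| ≤ 1 := hvol
    _ ≤ ε * N := hεN
    _ ≤ ε * ((volume S).toReal + N) := by nlinarith

/-! ## §C2 The `t = 1` slice is a THEOREM (any counterexample needs `t ≥ 2`) -/

/-- The crux body at `t = 1` (primes in a segment of a progression of modulus `≤ L`). -/
def RelativeDimOneAtOne : Prop :=
  ∀ L : ℕ, ∀ ε : ℝ, 0 < ε → ∃ N₀ : ℕ, ∀ N : ℕ, N₀ ≤ N →
    ∀ Ψ : Fin 1 → AffLinForm 1, IsNondegenerateSystem Ψ → affLinSize Ψ N ≤ L →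
      ∀ K : Set (Fin 1 → ℝ), Convex ℝ K → K ⊆ realBox 1 N → Concl ε N Ψ K

/-- The crux restricted to `t = 1` is exactly `RelativeDimOneAtOne`. -/
theorem relativeDimOne_one (h : RelativeDimOne) : RelativeDimOneAtOne := fun L ε hε => h 1 L le_rfl ε hε

/-- **The `t = 1` slice of the crux HOLDS unconditionally**: the absolute form at `t = 1` is in the
tree (`PrimeCellsRelative.Sketch.stub_dimOne_one`, Green–Tao 2010 Thm. 4.5 at level `s = 1` plus the
§4 reduction — a single form has finite complexity), and absolute ⟹ relative exactly as in
`Theorems/LeeYangFibresRelativeDimOne.relativeDimOne_of_dimOne` (`S ≥ 0` forces `β_∞𝔖 ≥ −N/2`).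
Consequence for disprovers: every counterexample to the crux has `t ≥ 2` (twin-prime territory). -/
theorem relativeDimOneAtOne_holds : RelativeDimOneAtOne := by
  intro L ε hε
  obtain ⟨N₀, hN₀⟩ :=
    Summit.Parity.GeneralizedHardyLittlewood.Cruxes.PrimeCellsRelative.Sketch.stub_dimOne_one L (min ε 1 / 2)
      (by positivity)
  refine ⟨N₀, fun N hN Ψ hΨ hL K hK hKN => ?_⟩
  have hb := hN₀ N hN Ψ hΨ hL K hK hKN
  unfold Concl
  have hS : 0 ≤ vonMangoldtSum Ψ K N :=
    Finset.sum_nonneg fun n _ => Finset.prod_nonneg fun i _ => ArithmeticFunction.vonMangoldt_nonneg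
  set S := vonMangoldtSum Ψ K N with hSdef
  set M := archFactor Ψ K * singularProduct Ψ with hMdef
  have hN0 : (0 : ℝ) ≤ N := Nat.cast_nonneg N
  have hε1 : min ε 1 / 2 ≤ ε / 2 := by
    have := min_le_left ε 1
    linarith
  have hε2 : min ε 1 / 2 ≤ 1 / 2 := by
    have := min_le_right ε 1
    linarith
  have hab := abs_le.mp hb
  have hM : -(1 / 2 * (N : ℝ)) ≤ M := by
    have h1 : min ε 1 / 2 * (N : ℝ) ≤ 1 / 2 * N := mul_le_mul_of_nonneg_right hε2 hN0
    linarith [hab.1, hab.2]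
  have hεM : -(ε / 2 * (N : ℝ)) ≤ ε * M := by
    have := mul_le_mul_of_nonneg_left hM hε.le
    linarith
  have h2 : min ε 1 / 2 * (N : ℝ) ≤ ε / 2 * N := mul_le_mul_of_nonneg_right hε1 hN0
  calc |S - M| ≤ min ε 1 / 2 * (N : ℝ) := hb
    _ ≤ ε * (M + N) := by nlinarith

end Summit.Parity.GeneralizedHardyLittlewood.Theorems.RelativeDimOne.Negative
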